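/-
Copyright: cell pub-balaban-gaps, seat ne8 (estimate NE7c), gen 18. Project licence.
-/
import Summits.QuantumFields.BalabanUV.T4Continuum.Spine.NE7c.LiveFactorGlobalCompact

/-!
# The member OF RECORD of road (δ) — (δ-global-compact): ONE threshold assignment `c : ℕ → ℕ` by absolute level for EVERY cutoff (file 11
# `LiveFactorGlobalCompact.shellWeightBound_of_globalCompact`, the member the one-family END of the NE7b lineage consumes, `ne/NE7c.md` §6 GEN-8 NOTE) — FIRES
# on the JOINT-LAW MODEL: ANY probability space per comparison, tests with LEVELS in the live window, ARBITRARILY DEPENDENT observables; its law-side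
# inputs (realized ledgers for every admissible assignment, finite dependence (FD), the own-level candidate sums (L2↓), the cover) are ALL DISCHARGED by
# σ-additivity, leaving exactly file 11's window bookkeeping (`n`, `B`, `W`, loss factors `t`, the window majorant) as hypotheses (row NE7c; junction J-27;
# MODEL, [folklore]) — the measure-level twin of file 47 (member (δ-1)) for the member of record

Cell `pub-balaban-gaps` (G2), seat ne8, estimate **NE7c** (`T4IndicatorShell.ShellWeightBound`; two-run artefact, NOT PRINTED in [Bałaban 1983–89], NOT
PROVED).  Proof-only file under `Spine/NE7c/`: imports this seat's file 11 `LiveFactorGlobalCompact` only (gen 8, p354120 ✓; through it the tree's `T4ShellMeasure`: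
`SlotLedger.of_realized`, `twoSidedShell`, `twoSidedShell_disjoint`).  The cell facts of file 47 (partition into the `2^τ` cells of the outcome vectors) are re-derived
INSIDE the proofs as `have`s (no new top-level duplicates).  Mathlib measure theory otherwise.  Nothing of Bałaban's is named; no `def`; 0 `sorry`.

THE QUESTION (`ne/NE7c.md` §4 row 51: the count letter is «identical under (δ-1) and, per level, under (δ-global…)»; file 47 fired member (δ-1)'s constructor on
the joint-law model).  The member OF RECORD for the one-family END is (δ-global-compact), whose constructor (file 11) takes, per comparison `K` and level `j`,
CANDIDATE SHELL WEIGHTS `w K j c ≥ 0` depending on the WHOLE assignment `c`, with (FD) finite dependence, (L2↓) own-coordinate candidate sums `≤ V_j·Z_K`, a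
cover of the pieces by `Σ_{j ∈ W K} w K j c`, realized ledgers for EVERY admissible `c`, and the window bookkeeping.  Does it fire on measure-valued data of the
joint-law model, and what is left as hypothesis?

ANSWER ([folklore]).  At comparison `K` the run lives on `(Ω_K, P_K)` (ANY probability space) and tests the measurable observables `u_{K,t}`, `t ∈ τ` (finite,
ARBITRARILY DEPENDENT), test `t` sitting at LEVEL `lev K t ∈ W K` with threshold `θ_{K,t} ≥ 0`, radius `0 ≤ ρ_{K,t}`, `2ρ_{K,t} ≤ ρ⋆_{lev K t} ≤ 1` (per-level
candidate spacing `ρ⋆_j`); the assignment `c` gives level `j` the factor `(1 − ρ⋆_j)^{c j}`.  TERMS = cells of the outcome vectors `ω : τ → Bool`; slot `t`'s piece =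
the cell's mass on «`u_t` in its two-sided shell at its level's candidate `c (lev K t)`»; `w K j c = Σ_{t : lev K t = j} P_K{u_t ∈ shell_t(c j)}` depends on `c` through
`c j` ONLY ⇒ (FD) with `D K j = j + 1`; (L2↓): `Σ_{m<n_j} w K j (c[j ↦ m]) = Σ_{t : lev = j} Σ_m P{u_t ∈ shell_m} ≤ #{t : lev K t = j} ≤ ν_j` (disjoint candidate
shells of ONE observable — the only use of the law) with `Z_K = 1`; cover with EQUALITY by the partition, regrouped by level (`Finset.sum_fiberwise_of_maps_to`).
* §1 `sum_measureReal_shell_le_one` (disjointness), `realizedLedger_global` (the realized `SlotLedger` of the model for EVERY assignment), **`shellWeightBound_globalJointLaw`**: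
  file 11's `shellWeightBound_of_globalCompact` FIRES — `∃ c, (∀ j, c j < n j) ∧ ShellWeightBound l₀ (fun _ => univ) (A c) (B c) (shA c) (shB c) (fun K =>
  Σ_t P^A_K{u^A_{K,t} ∈ shell_t(c)} + Σ_t P^B_K{u^B_{K,t} ∈ shell_t(c)})` — for ANY laws, given ONLY file 11's window bookkeeping: candidate counts `n_j ≥ 1`, live
  windows `W K` with `lev K t ∈ W K`, their transposes `B j` (`j ∈ W K → K ∈ B j`), per-level test counts `#{t : lev K t = j} ≤ ν_j`, loss factors `t_j > 0` with
  `Σ_{j<J} t_j⁻¹ < 1`, and the window majorant `Σ_{j ∈ W K} t_j·(2·#B_j·ν_j∕n_j) ≤ C·ϑ^K` (file 11 §5 supplies `t_j = (1−η)⁻¹η^{−j}` and the geometric majorant).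

WHAT THIS SHOWS ∕ DOES NOT SHOW (honest).  SHOWS: for the member OF RECORD as for (δ-1) (file 47), every LAW-SIDE hypothesis of the constructor is σ-additivity:
(FD) holds with `D K j = j + 1`, (L2↓) with `V_j = ν_j`, the ledgers and the cover by the cell partition — for arbitrarily dependent tests on any probability
space; what remains is the WINDOW BOOKKEEPING (which levels are live at which comparison, how many tests per level, the candidate-count rate) — node U1b ∕ (W1)
data, not analysis.  DOES NOT SHOW: adaptive trees for this member (their per-level count is (L2↓) = `T4ShellMeasure` §8 restricted to the stages carrying level-`j`
tests — file 13; the measure-level lift would follow file 50's pattern), anything about Bałaban's tree (node O), (L1-levelwise), two-run closeness.  BY-NAME EFFECT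
ON THE WALL: none (MODEL).  VERDICT WORD UNCHANGED: WORK-bound behind node O; INSTANCE 0∕1.  NE7c ∕ NE7b NOT PRINTED ∕ NOT PROVED; spine 0∕9; one finite T⁴ —
NOT ℝ⁴, NOT infinite volume, NOT the mass gap, NOT Clay.
HONEST DEPENDENCY (cell): continuum YM on T⁴ ⇐ BetaPertH ∧ nine spine estimates (0∕9 proved); BetaPertH ⇐ (D1) ∧ (D4) ∧ CAP+tail.
-/

set_option autoImplicit false

noncomputable section

open MeasureTheory Finset Set
open scoped Classical
open Literature.MathematicalPhysics.QuantumFieldTheory.Balaban1983to89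
open Literature.MathematicalPhysics.QuantumFieldTheory.Balaban1983to89.T4ShellMeasure
open Summit.QuantumFields.BalabanUV.T4Continuum.Spine.NE7c.LiveFactorGlobalCompact (shellWeightBound_of_globalCompact)

namespace Summit.QuantumFields.BalabanUV.T4Continuum.Spine.NE7c.LiveFactorGlobalJointLawModel

/-! ## §1 The joint-law model of the GLOBAL member -/

section Model

variable {τ : Type*} [Fintype τ] [DecidableEq τ] {Ω : ℕ → Type*} [∀ K, MeasurableSpace (Ω K)] (P : ∀ K, Measure (Ω K))
  [∀ K, IsProbabilityMeasure (P K)] (u : ∀ K, τ → Ω K → ℝ) (θ ρ : ℕ → τ → ℝ) (ρs : ℕ → ℝ) (lev : ℕ → τ → ℕ)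

/-- Disjointness of the candidate shells of ONE observable at its level's spacing: `Σ_{m<n} P{u ∈ twoSidedShell θ ρ⋆ ρ m} ≤ 1` (`0 ≤ θ`, `0 ≤ ρ`, `2ρ ≤ ρ⋆ ≤ 1`). [folklore] -/
theorem sum_measureReal_shell_le_one (K : ℕ) {v : Ω K → ℝ} (hv : Measurable v) {a r rs : ℝ} (ha : 0 ≤ a) (hr : 0 ≤ r) (h2 : 2 * r ≤ rs) (h1 : rs ≤ 1)
    (n : ℕ) : ∑ m ∈ range n, (P K).real (v ⁻¹' twoSidedShell a rs r m) ≤ 1 := by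
  calc ∑ m ∈ range n, (P K).real (v ⁻¹' twoSidedShell a rs r m)
      = (P K).real (⋃ m ∈ range n, v ⁻¹' twoSidedShell a rs r m) := by
        rw [measureReal_biUnion_finset (fun i _ j _ hij => (twoSidedShell_disjoint ha hr h2 h1 hij).preimage v) (fun i _ => hv measurableSet_Ico)]
    _ ≤ (P K).real (univ : Set (Ω K)) := measureReal_mono (subset_univ _)
    _ = 1 := probReal_univ

/-- **THE REALIZED LEDGER OF THE GLOBAL MODEL, FOR EVERY ASSIGNMENT `c`** (`SlotLedger.of_realized`, tilt `a = 0`): terms = cells of the outcome vectors at the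
assignment's thresholds, slot `t`'s piece = the cell's mass on «`u_t` in its shell at candidate `c (lev K t)`», shell part = the mass on «some `u_t` in its shell»;
needs measurability of the `u_t` only (unit total weight by the partition). [folklore] -/
theorem realizedLedger_global (hu : ∀ K t, Measurable (u K t)) (l₀ : ℝ) (c : ℕ → ℕ) :
    SlotLedger l₀ (fun _ => (univ : Finset (τ → Bool)))
      (fun K (_ : ℝ) (ω : τ → Bool) => (P K).real (⋂ t, (u K t) ⁻¹' (if ω t then Iio (θ K t * (1 - ρs (lev K t)) ^ c (lev K t)) else Ici (θ K t * (1 - ρs (lev K t)) ^ c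
          (lev K t)))))
      (fun K (_ : ℝ) (ω : τ → Bool) => (P K).real ((⋂ t, (u K t) ⁻¹' (if ω t then Iio (θ K t * (1 - ρs (lev K t)) ^ c (lev K t)) else Ici (θ K t * (1 - ρs (lev K t)) ^ c
          (lev K t)))) ∩ ⋃ t, (u K t) ⁻¹' twoSidedShell (θ K t) (ρs (lev K t)) (ρ K t) (c (lev K t))))
      (fun _ => (univ : Finset τ))
      (fun K (_ : ℝ) (t : τ) (ω : τ → Bool) => (P K).real ((⋂ t, (u K t) ⁻¹' (if ω t then Iio (θ K t * (1 - ρs (lev K t)) ^ c (lev K t)) else Ici (θ K t * (1 - ρs (lev K t)) ^ c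
          (lev K t)))) ∩ (u K t) ⁻¹' twoSidedShell (θ K t) (ρs (lev K t)) (ρ K t) (c (lev K t))))
      (fun K s => Real.exp (2 * 0) *
        ((∑ ω ∈ (univ : Finset (τ → Bool)), (fun K (_ : ℝ) (t : τ) (ω : τ → Bool) => (P K).real ((⋂ t, (u K t) ⁻¹' (if ω t then Iio (θ K t * (1 - ρs (lev K t)) ^ c (lev K t)) else
            Ici (θ K t * (1 - ρs (lev K t)) ^ c (lev K t)))) ∩ (u K t) ⁻¹' twoSidedShell (θ K t) (ρs (lev K t)) (ρ K t) (c (lev K t)))) K 0 s ω) /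
          ∑ ω ∈ (univ : Finset (τ → Bool)), (fun K (_ : ℝ) (ω : τ → Bool) => (P K).real (⋂ t, (u K t) ⁻¹' (if ω t then Iio (θ K t * (1 - ρs (lev K t)) ^ c (lev K t)) else Ici
              (θ K t * (1 - ρs (lev K t)) ^ c (lev K t))))) K 0 ω)) := by
  -- the partition: the cells are measurable, pairwise disjoint and exhaust the space
  have hcellm : ∀ K (ω : τ → Bool), MeasurableSet (⋂ t, (u K t) ⁻¹' (if ω t then Iio (θ K t * (1 - ρs (lev K t)) ^ c (lev K t)) else Ici (θ K t * (1 - ρs (lev K t)) ^ c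
      (lev K t)))) := fun K ω =>
    MeasurableSet.iInter fun t => hu K t (by split <;> [exact measurableSet_Iio; exact measurableSet_Ici])
  have hU : ∀ K, (⋃ ω : τ → Bool, (⋂ t, (u K t) ⁻¹' (if ω t then Iio (θ K t * (1 - ρs (lev K t)) ^ c (lev K t)) else Ici (θ K t * (1 - ρs (lev K t)) ^ c (lev K t))))) = univ := by
    intro K
    refine Set.eq_univ_of_forall fun x => Set.mem_iUnion.2 ⟨fun t => decide (u K t x < θ K t * (1 - ρs (lev K t)) ^ c (lev K t)), Set.mem_iInter.2 fun t => ?_⟩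
    rw [Set.mem_preimage]
    by_cases h : u K t x < θ K t * (1 - ρs (lev K t)) ^ c (lev K t)
    · simp only [h, decide_true, if_true, Set.mem_Iio]
    · simp only [h, decide_false, Bool.false_eq_true, if_false, Set.mem_Ici]; exact not_lt.1 h
  have hdisj : ∀ K, Pairwise (Function.onFun Disjoint fun ω : τ → Bool => (⋂ t, (u K t) ⁻¹' (if ω t then Iio (θ K t * (1 - ρs (lev K t)) ^ c (lev K t)) else Ici (θ K t * (1 - ρs
      (lev K t)) ^ c (lev K t))))) := by
    intro K ω ω' hne
    change Disjoint (⋂ t, (u K t) ⁻¹' (if ω t then Iio (θ K t * (1 - ρs (lev K t)) ^ c (lev K t)) else Ici (θ K t * (1 - ρs (lev K t)) ^ c (lev K t)))) (⋂ t, (u K t) ⁻¹'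
        (if ω' t then Iio (θ K t * (1 - ρs (lev K t)) ^ c (lev K t)) else Ici (θ K t * (1 - ρs (lev K t)) ^ c (lev K t))))
    obtain ⟨t, ht⟩ := Function.ne_iff.1 hne
    rw [Set.disjoint_left]
    intro x hx hx'
    have h1 := Set.mem_iInter.1 hx t; have h2 := Set.mem_iInter.1 hx' t; rw [Set.mem_preimage] at h1 h2
    cases hω : ω t <;> cases hω' : ω' t <;> first
      | exact ht (hω.trans hω'.symm)
      | (rw [hω] at h1; rw [hω'] at h2
         simp only [Bool.false_eq_true, if_false, Set.mem_Ici, if_true, Set.mem_Iio] at h1 h2; linarith)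
  have htot : ∀ K, ∑ ω : τ → Bool, (P K).real (⋂ t, (u K t) ⁻¹' (if ω t then Iio (θ K t * (1 - ρs (lev K t)) ^ c (lev K t)) else Ici (θ K t * (1 - ρs (lev K t)) ^ c (lev K t)))) =
      1 := fun K => by
    rw [← measureReal_iUnion_fintype (hdisj K) (hcellm K), hU K, probReal_univ]
  refine SlotLedger.of_realized (a := 0) ?_ ?_ ?_ ?_ ?_ ?_ ?_
  · intro K t _ ω _; exact measureReal_nonneg
  · intro K t _ ω _; exact measureReal_mono Set.inter_subset_left
  · intro K t _ ω _
    show (P K).real ((⋂ t, (u K t) ⁻¹' (if ω t then Iio (θ K t * (1 - ρs (lev K t)) ^ c (lev K t)) else Ici (θ K t * (1 - ρs (lev K t)) ^ c (lev K t)))) ∩ ⋃ t,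
        (u K t) ⁻¹' twoSidedShell (θ K t) (ρs (lev K t)) (ρ K t) (c (lev K t))) ≤ ∑ t, (P K).real ((⋂ t, (u K t) ⁻¹' (if ω t then Iio (θ K t * (1 - ρs (lev K t)) ^ c
            (lev K t)) else Ici (θ K t * (1 - ρs (lev K t)) ^ c (lev K t)))) ∩ (u K t) ⁻¹' twoSidedShell (θ K t) (ρs (lev K t)) (ρ K t) (c (lev K t)))
    rw [Set.inter_iUnion]; exact measureReal_iUnion_fintype_le _
  · intro K s _ ω _; exact measureReal_nonneg
  · intro K
    show 0 < ∑ ω : τ → Bool, (P K).real (⋂ t, (u K t) ⁻¹' (if ω t then Iio (θ K t * (1 - ρs (lev K t)) ^ c (lev K t)) else Ici (θ K t * (1 - ρs (lev K t)) ^ c (lev K t))))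
    rw [htot]; exact one_pos
  · intro K t _ s _; rw [Real.exp_zero, one_mul]
  · intro K t _; simp only [Real.exp_zero, one_mul, le_refl]

/-- **PARTITION at the assignment's thresholds**: for every assignment `c`, comparison `K` and measurable `E`, the masses of `E` on the cells sum to `P_K(E)`.
[folklore] -/
theorem sum_measureReal_cell_inter_global (hu : ∀ K t, Measurable (u K t)) (c : ℕ → ℕ) (K : ℕ) {E : Set (Ω K)} (hE : MeasurableSet E) :
    ∑ ω : τ → Bool, (P K).real ((⋂ t, (u K t) ⁻¹' (if ω t then Iio (θ K t * (1 - ρs (lev K t)) ^ c (lev K t)) else Ici (θ K t * (1 - ρs (lev K t)) ^ c (lev K t)))) ∩ E) =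
        (P K).real E := by
  have hcellm : ∀ (ω : τ → Bool), MeasurableSet (⋂ t, (u K t) ⁻¹' (if ω t then Iio (θ K t * (1 - ρs (lev K t)) ^ c (lev K t)) else Ici (θ K t * (1 - ρs (lev K t)) ^ c
      (lev K t)))) := fun ω =>
    MeasurableSet.iInter fun t => hu K t (by split <;> [exact measurableSet_Iio; exact measurableSet_Ici])
  have hU : (⋃ ω : τ → Bool, (⋂ t, (u K t) ⁻¹' (if ω t then Iio (θ K t * (1 - ρs (lev K t)) ^ c (lev K t)) else Ici (θ K t * (1 - ρs (lev K t)) ^ c (lev K t))))) = univ := by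
    refine Set.eq_univ_of_forall fun x => Set.mem_iUnion.2 ⟨fun t => decide (u K t x < θ K t * (1 - ρs (lev K t)) ^ c (lev K t)), Set.mem_iInter.2 fun t => ?_⟩
    rw [Set.mem_preimage]
    by_cases h : u K t x < θ K t * (1 - ρs (lev K t)) ^ c (lev K t)
    · simp only [h, decide_true, if_true, Set.mem_Iio]
    · simp only [h, decide_false, Bool.false_eq_true, if_false, Set.mem_Ici]; exact not_lt.1 h
  have hdisj : Pairwise (Function.onFun Disjoint fun ω : τ → Bool => (⋂ t, (u K t) ⁻¹' (if ω t then Iio (θ K t * (1 - ρs (lev K t)) ^ c (lev K t)) else Ici (θ K t * (1 - ρs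
      (lev K t)) ^ c (lev K t)))) ∩ E) := by
    intro ω ω' hne
    change Disjoint ((⋂ t, (u K t) ⁻¹' (if ω t then Iio (θ K t * (1 - ρs (lev K t)) ^ c (lev K t)) else Ici (θ K t * (1 - ρs (lev K t)) ^ c (lev K t)))) ∩ E) ((⋂ t, (u K t) ⁻¹'
        (if ω' t then Iio (θ K t * (1 - ρs (lev K t)) ^ c (lev K t)) else Ici (θ K t * (1 - ρs (lev K t)) ^ c (lev K t)))) ∩ E)
    refine Disjoint.mono Set.inter_subset_left Set.inter_subset_left ?_
    obtain ⟨t, ht⟩ := Function.ne_iff.1 hne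
    rw [Set.disjoint_left]
    intro x hx hx'
    have h1 := Set.mem_iInter.1 hx t; have h2 := Set.mem_iInter.1 hx' t; rw [Set.mem_preimage] at h1 h2
    cases hω : ω t <;> cases hω' : ω' t <;> first
      | exact ht (hω.trans hω'.symm)
      | (rw [hω] at h1; rw [hω'] at h2
         simp only [Bool.false_eq_true, if_false, Set.mem_Ici, if_true, Set.mem_Iio] at h1 h2; linarith)
  rw [← measureReal_iUnion_fintype hdisj (fun ω => (hcellm ω).inter hE), ← Set.iUnion_inter, hU, Set.univ_inter]

end Model

/-! ## §2 The member of record FIRES on the joint-law model -/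

section Main

variable {τ : Type*} [Fintype τ] [DecidableEq τ] {ΩA ΩB : ℕ → Type*} [∀ K, MeasurableSpace (ΩA K)] [∀ K, MeasurableSpace (ΩB K)]
  (PA : ∀ K, Measure (ΩA K)) (PB : ∀ K, Measure (ΩB K)) [∀ K, IsProbabilityMeasure (PA K)] [∀ K, IsProbabilityMeasure (PB K)]
  (uA : ∀ K, τ → ΩA K → ℝ) (uB : ∀ K, τ → ΩB K → ℝ) (θ ρA ρB : ℕ → τ → ℝ) (ρs : ℕ → ℝ) (levA levB : ℕ → τ → ℕ)

/-- **THE MEMBER OF RECORD (δ-global-compact) FIRES ON THE JOINT-LAW MODEL.**  Data: per comparison `K`, run `X` on ITS OWN probability space with measurable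
observables `u^X_{K,t}` (`t ∈ τ` finite, ANY dependence), test `t` at LEVEL `lev^X K t ∈ W K`, thresholds `θ_{K,t} ≥ 0`, radii `0 ≤ ρ^X_{K,t}`, `2ρ^X_{K,t} ≤ ρ⋆_{lev} ≤ 1`,
per-level test counts `#{t : lev^X K t = j} ≤ ν_j`; and file 11's WINDOW BOOKKEEPING as hypotheses: candidate counts `n_j ≥ 1`, live windows `W K` with transposes
`B j`, loss factors `t_j > 0`, `Σ_{j<J} t_j⁻¹ < 1`, the window majorant `Σ_{j ∈ W K} t_j·(2·#B_j·ν_j∕n_j) ≤ C·ϑ^K`.  Conclusion: ONE GLOBAL assignment `c` (`c j < n_j`)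
such that `T4IndicatorShell.ShellWeightBound` holds BY NAME for the two runs written with `c` AT EVERY CUTOFF, `Wsh K = Σ_t P^A_K{u^A_{K,t} ∈ shell_t(c)} +
Σ_t P^B_K{u^B_{K,t} ∈ shell_t(c)}` — `LiveFactorGlobalCompact.shellWeightBound_of_globalCompact` with (FD) `D K j = j + 1`, (L2↓) `V_j = ν_j`, `Z_K = 1`, ledgers and
cover DISCHARGED by σ-additivity. [folklore] -/
theorem shellWeightBound_globalJointLaw (l₀ : ℝ) {C ϑ : ℝ} (n : ℕ → ℕ) (hn : ∀ j, 0 < n j) (B W : ℕ → Finset ℕ) (hWB : ∀ K j, j ∈ W K → K ∈ B j)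
    (huA : ∀ K t, Measurable (uA K t)) (huB : ∀ K t, Measurable (uB K t)) (hθ : ∀ K t, 0 ≤ θ K t) (hs1 : ∀ j, ρs j ≤ 1)
    (hA0 : ∀ K t, 0 ≤ ρA K t) (hA2 : ∀ K t, 2 * ρA K t ≤ ρs (levA K t)) (hB0 : ∀ K t, 0 ≤ ρB K t) (hB2 : ∀ K t, 2 * ρB K t ≤ ρs (levB K t))
    (hlevA : ∀ K t, levA K t ∈ W K) (hlevB : ∀ K t, levB K t ∈ W K) (ν : ℕ → ℕ)
    (hνA : ∀ K j, (univ.filter fun t => levA K t = j).card ≤ ν j) (hνB : ∀ K j, (univ.filter fun t => levB K t = j).card ≤ ν j)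
    (tl : ℕ → ℝ) (htl0 : ∀ j, 0 < tl j) (htl : ∀ J, ∑ j ∈ range J, (tl j)⁻¹ < 1) (hϑ0 : 0 ≤ ϑ) (hϑ1 : ϑ < 1)
    (hgeo : ∀ K, ∑ j ∈ W K, tl j * (2 * ((B j).card : ℝ) * ν j / n j) ≤ C * ϑ ^ K) :
    ∃ c : ℕ → ℕ, (∀ j, c j < n j) ∧
      T4IndicatorShell.ShellWeightBound l₀ (fun _ => (univ : Finset (τ → Bool)))
        (fun K (_ : ℝ) (ω : τ → Bool) => (PA K).real (⋂ t, (uA K t) ⁻¹' (if ω t then Iio (θ K t * (1 - ρs (levA K t)) ^ c (levA K t)) else Ici (θ K t * (1 - ρs (levA K t)) ^ c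
            (levA K t)))))
        (fun K (_ : ℝ) (ω : τ → Bool) => (PB K).real (⋂ t, (uB K t) ⁻¹' (if ω t then Iio (θ K t * (1 - ρs (levB K t)) ^ c (levB K t)) else Ici (θ K t * (1 - ρs (levB K t)) ^ c
            (levB K t)))))
        (fun K (_ : ℝ) (ω : τ → Bool) => (PA K).real ((⋂ t, (uA K t) ⁻¹' (if ω t then Iio (θ K t * (1 - ρs (levA K t)) ^ c (levA K t)) else Ici (θ K t * (1 - ρs (levA K t)) ^ c
            (levA K t)))) ∩ ⋃ t, (uA K t) ⁻¹' twoSidedShell (θ K t) (ρs (levA K t)) (ρA K t) (c (levA K t))))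
        (fun K (_ : ℝ) (ω : τ → Bool) => (PB K).real ((⋂ t, (uB K t) ⁻¹' (if ω t then Iio (θ K t * (1 - ρs (levB K t)) ^ c (levB K t)) else Ici (θ K t * (1 - ρs (levB K t)) ^ c
            (levB K t)))) ∩ ⋃ t, (uB K t) ⁻¹' twoSidedShell (θ K t) (ρs (levB K t)) (ρB K t) (c (levB K t))))
        (fun K => ∑ t, (PA K).real ((uA K t) ⁻¹' twoSidedShell (θ K t) (ρs (levA K t)) (ρA K t) (c (levA K t))) + ∑ t, (PB K).real ((uB K t) ⁻¹' twoSidedShell (θ K t) (ρs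
            (levB K t)) (ρB K t) (c (levB K t)))) := by
  -- the per-test shell masses summed over the cells are the marginal shell masses (partition)
  have eA : ∀ (c : ℕ → ℕ) (K : ℕ) (t : τ), ∑ ω : τ → Bool, (PA K).real ((⋂ t, (uA K t) ⁻¹' (if ω t then Iio (θ K t * (1 - ρs (levA K t)) ^ c (levA K t)) else Ici (θ K t * (1 - ρs
      (levA K t)) ^ c (levA K t)))) ∩ (uA K t) ⁻¹' twoSidedShell (θ K t) (ρs (levA K t)) (ρA K t) (c (levA K t))) = (PA K).real ((uA K t) ⁻¹' twoSidedShell (θ K t) (ρs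
          (levA K t)) (ρA K t) (c (levA K t))) :=
    fun c K t => sum_measureReal_cell_inter_global PA uA θ ρs levA huA c K ((huA K t) measurableSet_Ico)
  have eB : ∀ (c : ℕ → ℕ) (K : ℕ) (t : τ), ∑ ω : τ → Bool, (PB K).real ((⋂ t, (uB K t) ⁻¹' (if ω t then Iio (θ K t * (1 - ρs (levB K t)) ^ c (levB K t)) else Ici (θ K t * (1 - ρs
      (levB K t)) ^ c (levB K t)))) ∩ (uB K t) ⁻¹' twoSidedShell (θ K t) (ρs (levB K t)) (ρB K t) (c (levB K t))) = (PB K).real ((uB K t) ⁻¹' twoSidedShell (θ K t) (ρs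
          (levB K t)) (ρB K t) (c (levB K t))) :=
    fun c K t => sum_measureReal_cell_inter_global PB uB θ ρs levB huB c K ((huB K t) measurableSet_Ico)
  have h1A : ∀ (c : ℕ → ℕ) (K : ℕ), ∑ ω : τ → Bool, (PA K).real (⋂ t, (uA K t) ⁻¹' (if ω t then Iio (θ K t * (1 - ρs (levA K t)) ^ c (levA K t)) else Ici (θ K t * (1 - ρs
      (levA K t)) ^ c (levA K t)))) = 1 := fun c K => by
    have h := sum_measureReal_cell_inter_global PA uA θ ρs levA huA c K (MeasurableSet.univ : MeasurableSet (univ : Set (ΩA K)))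
    simp only [Set.inter_univ, probReal_univ] at h; exact h
  have h1B : ∀ (c : ℕ → ℕ) (K : ℕ), ∑ ω : τ → Bool, (PB K).real (⋂ t, (uB K t) ⁻¹' (if ω t then Iio (θ K t * (1 - ρs (levB K t)) ^ c (levB K t)) else Ici (θ K t * (1 - ρs
      (levB K t)) ^ c (levB K t)))) = 1 := fun c K => by
    have h := sum_measureReal_cell_inter_global PB uB θ ρs levB huB c K (MeasurableSet.univ : MeasurableSet (univ : Set (ΩB K)))
    simp only [Set.inter_univ, probReal_univ] at h; exact h
  obtain ⟨c, hc, hSWB⟩ := shellWeightBound_of_globalCompact (l₀ := l₀) (a := 0) (C := C) (ϑ := ϑ)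
    (T := fun _ => (univ : Finset (τ → Bool))) n hn B W hWB
    (A := fun c K (_ : ℝ) (ω : τ → Bool) => (PA K).real (⋂ t, (uA K t) ⁻¹' (if ω t then Iio (θ K t * (1 - ρs (levA K t)) ^ c (levA K t)) else Ici (θ K t * (1 - ρs (levA K t)) ^ c
        (levA K t)))))
    (A' := fun c K (_ : ℝ) (ω : τ → Bool) => (PB K).real (⋂ t, (uB K t) ⁻¹' (if ω t then Iio (θ K t * (1 - ρs (levB K t)) ^ c (levB K t)) else Ici (θ K t * (1 - ρs
        (levB K t)) ^ c (levB K t)))))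
    (shA := fun c K (_ : ℝ) (ω : τ → Bool) => (PA K).real ((⋂ t, (uA K t) ⁻¹' (if ω t then Iio (θ K t * (1 - ρs (levA K t)) ^ c (levA K t)) else Ici (θ K t * (1 - ρs
        (levA K t)) ^ c (levA K t)))) ∩ ⋃ t, (uA K t) ⁻¹' twoSidedShell (θ K t) (ρs (levA K t)) (ρA K t) (c (levA K t))))
    (shA' := fun c K (_ : ℝ) (ω : τ → Bool) => (PB K).real ((⋂ t, (uB K t) ⁻¹' (if ω t then Iio (θ K t * (1 - ρs (levB K t)) ^ c (levB K t)) else Ici (θ K t * (1 - ρs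
        (levB K t)) ^ c (levB K t)))) ∩ ⋃ t, (uB K t) ⁻¹' twoSidedShell (θ K t) (ρs (levB K t)) (ρB K t) (c (levB K t))))
    (SA := fun _ => (univ : Finset τ)) (SA' := fun _ => (univ : Finset τ))
    (pieceA := fun c K (_ : ℝ) (t : τ) (ω : τ → Bool) => (PA K).real ((⋂ t, (uA K t) ⁻¹' (if ω t then Iio (θ K t * (1 - ρs (levA K t)) ^ c (levA K t)) else Ici (θ K t * (1 - ρs
        (levA K t)) ^ c (levA K t)))) ∩ (uA K t) ⁻¹' twoSidedShell (θ K t) (ρs (levA K t)) (ρA K t) (c (levA K t))))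
    (pieceA' := fun c K (_ : ℝ) (t : τ) (ω : τ → Bool) => (PB K).real ((⋂ t, (uB K t) ⁻¹' (if ω t then Iio (θ K t * (1 - ρs (levB K t)) ^ c (levB K t)) else Ici (θ K t * (1 - ρs
        (levB K t)) ^ c (levB K t)))) ∩ (uB K t) ⁻¹' twoSidedShell (θ K t) (ρs (levB K t)) (ρB K t) (c (levB K t))))
    (fun c _ => realizedLedger_global PA uA θ ρA ρs levA huA l₀ c) (fun c _ => realizedLedger_global PB uB θ ρB ρs levB huB l₀ c)
    (ZA := fun _ => 1) (ZB := fun _ => 1) (fun _ => one_pos) (fun _ => one_pos)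
    (fun c _ K => (h1A c K).symm.le) (fun c _ K => (h1B c K).symm.le)
    (fun K j c => ∑ t ∈ univ.filter (fun t => levA K t = j), (PA K).real ((uA K t) ⁻¹' twoSidedShell (θ K t) (ρs j) (ρA K t) (c j)))
    (fun K j c => ∑ t ∈ univ.filter (fun t => levB K t = j), (PB K).real ((uB K t) ⁻¹' twoSidedShell (θ K t) (ρs j) (ρB K t) (c j)))
    (fun K j c => sum_nonneg fun t _ => measureReal_nonneg) (fun K j c => sum_nonneg fun t _ => measureReal_nonneg)
    (fun K j => j + 1)
    (fun K j c c' _ _ hcc' => by simp only [hcc' j (Nat.lt_succ_self j)])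
    (fun K j c c' _ _ hcc' => by simp only [hcc' j (Nat.lt_succ_self j)])
    (fun j => (ν j : ℝ)) (fun j => Nat.cast_nonneg _)
    (fun K j c _ => by
      simp only [Function.update_self]
      rw [sum_comm, mul_one]
      calc ∑ t ∈ univ.filter (fun t => levA K t = j), ∑ m ∈ range (n j), (PA K).real ((uA K t) ⁻¹' twoSidedShell (θ K t) (ρs j) (ρA K t) m)
          ≤ ∑ t ∈ univ.filter (fun t => levA K t = j), (1 : ℝ) := sum_le_sum fun t ht => by
            have hj : levA K t = j := (Finset.mem_filter.1 ht).2
            exact sum_measureReal_shell_le_one PA K (huA K t) (hθ K t) (hA0 K t) (hj ▸ hA2 K t) (hs1 j) (n j)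
        _ ≤ ν j := by rw [sum_const, nsmul_eq_mul, mul_one]; exact_mod_cast hνA K j)
    (fun K j c _ => by
      simp only [Function.update_self]
      rw [sum_comm, mul_one]
      calc ∑ t ∈ univ.filter (fun t => levB K t = j), ∑ m ∈ range (n j), (PB K).real ((uB K t) ⁻¹' twoSidedShell (θ K t) (ρs j) (ρB K t) m)
          ≤ ∑ t ∈ univ.filter (fun t => levB K t = j), (1 : ℝ) := sum_le_sum fun t ht => by
            have hj : levB K t = j := (Finset.mem_filter.1 ht).2
            exact sum_measureReal_shell_le_one PB K (huB K t) (hθ K t) (hB0 K t) (hj ▸ hB2 K t) (hs1 j) (n j)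
        _ ≤ ν j := by rw [sum_const, nsmul_eq_mul, mul_one]; exact_mod_cast hνB K j)
    (fun c _ K => by
      show ∑ t, ∑ ω : τ → Bool, (PA K).real ((⋂ t, (uA K t) ⁻¹' (if ω t then Iio (θ K t * (1 - ρs (levA K t)) ^ c (levA K t)) else Ici (θ K t * (1 - ρs (levA K t)) ^ c
          (levA K t)))) ∩ (uA K t) ⁻¹' twoSidedShell (θ K t) (ρs (levA K t)) (ρA K t) (c (levA K t))) ≤ _
      rw [sum_congr rfl fun t _ => eA c K t,
        ← Finset.sum_fiberwise_of_maps_to (s := (univ : Finset τ)) (t := W K) (g := fun t => levA K t) (fun t _ => hlevA K t)]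
      refine le_of_eq (sum_congr rfl fun j _ => sum_congr rfl fun t ht => ?_)
      rw [(Finset.mem_filter.1 ht).2])
    (fun c _ K => by
      show ∑ t, ∑ ω : τ → Bool, (PB K).real ((⋂ t, (uB K t) ⁻¹' (if ω t then Iio (θ K t * (1 - ρs (levB K t)) ^ c (levB K t)) else Ici (θ K t * (1 - ρs (levB K t)) ^ c
          (levB K t)))) ∩ (uB K t) ⁻¹' twoSidedShell (θ K t) (ρs (levB K t)) (ρB K t) (c (levB K t))) ≤ _
      rw [sum_congr rfl fun t _ => eB c K t,
        ← Finset.sum_fiberwise_of_maps_to (s := (univ : Finset τ)) (t := W K) (g := fun t => levB K t) (fun t _ => hlevB K t)]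
      refine le_of_eq (sum_congr rfl fun j _ => sum_congr rfl fun t ht => ?_)
      rw [(Finset.mem_filter.1 ht).2])
    tl htl0 htl hϑ0 hϑ1 hgeo
  refine ⟨c, hc, ?_⟩
  have e : (fun K => (realizedLedger_global PA uA θ ρA ρs levA huA l₀ c).omega K + (realizedLedger_global PB uB θ ρB ρs levB huB l₀ c).omega K) =
      (fun K => ∑ t, (PA K).real ((uA K t) ⁻¹' twoSidedShell (θ K t) (ρs (levA K t)) (ρA K t) (c (levA K t))) + ∑ t, (PB K).real ((uB K t) ⁻¹' twoSidedShell (θ K t) (ρs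
          (levB K t)) (ρB K t) (c (levB K t)))) := by
    funext K
    simp only [SlotLedger.omega, mul_zero, Real.exp_zero, one_mul]
    rw [h1A, h1B]
    simp only [div_one]
    rw [sum_congr rfl fun t _ => eA c K t, sum_congr rfl fun t _ => eB c K t]
  rw [← e]
  exact hSWB

end Main

end Summit.QuantumFields.BalabanUV.T4Continuum.Spine.NE7c.LiveFactorGlobalJointLawModel

end
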